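import Mathlib.Analysis.InnerProductSpace.PiL2
import Mathlib.Analysis.Calculus.ContDiff.Basic
import Mathlib.Analysis.Calculus.ContDiff.Bounds
import Mathlib.Analysis.Calculus.FDeriv.Symmetric
import Mathlib.Analysis.InnerProductSpace.Calculus
import Mathlib.Algebra.Order.Chebyshev
import Literature.Analysis.FluidPDE.VectorCalculus
import HarnessLib

/-!
# Coordinate partial derivatives of smooth scalar functions on Euclidean space

Analysis/FluidPDE support file (folklore multivariable calculus in coordinates), written for
energy estimates in which higher derivatives must carry the Hilbert (sum of squares of
components) structure rather than Mathlib's operator norms of multilinear maps; first consumer: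
the discharge of `Literature.Analysis.FluidPDE.tao2011_hasBoundedSobolevNormsOn_of_memSobolevX` (Tao 2011,
Cor. 4.3 + Thm. 5.4 (iv)) by the vorticity energy method, where all estimates are carried out on
the scalar components `∂^α uᵢ`.

For a scalar function `f` on `𝔼 = EuclideanSpace ℝ ι` we define

* `pderiv l f = ∂ₗ f` (`= Df(x) eₗ`), `ipderiv α f = ∂_{α 0} ⋯ ∂_{α (m-1)} f` along a word
  `α : Fin m → ι`, and the masked variant `ipderivSub α b f` (only the letters selected by
  `b : Fin m → Bool`), `maskCard b` = number of selected letters;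
* `dnormSq m f x = ∑_α (∂^α f (x))²` and `dnorm m f x = (dnormSq m f x)^{1/2} = |∇ᵐ f (x)|`
  (Euclidean norm of the coordinate tensor), `dvec m f x` = the tuple `(∂^α f (x))_α ∈ ℝ^{ιᵐ}`;
* `famVec g x = (g_c (x))_c ∈ ℝ^κ` for a finite family of scalar functions (to feed vector-valued
  Sobolev inequalities with sums of squares);
* for a vector field `v` on `ℝ^ι`: `levelSq m v x = |∇ᵐ v (x)|² = ∑ᵢ ∑_{|β| = m} (∂^β vᵢ)²`, the
  vorticity components `vortComp v k i = Ω_{ki} = ∂ₖvᵢ − ∂ᵢvₖ` and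
  `vortSq m v x = |∇ᵐ Ω (x)|² = ∑_{k,i} ∑_{|β| = m} (∂^β Ω_{ki})²`, with the pointwise algebra
  `|∇ᵐ Ω|² ≤ 4 |∇^{m+1} v|²` (`vortSq_le_four_mul_levelSq_succ`), the div–curl identity
  `∑ a_{ki}² = ½ ∑ (a_{ki} − a_{ik})² + ∑ a_{ki} a_{ik}` and "derivatives of divergence-free fields
  are divergence free" (`sum_pderiv_ipderiv_eq_zero`; the coordinate hypothesis
  `∀ x, ∑ᵢ ∂ᵢvᵢ(x) = 0` is `Fluid.IsDivFree v` by the bridges of the last section).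

Proved: smoothness and linearity of `∂ₗ`, `∂^α`; Leibniz for `∂ₗ`; Schwarz (`∂ₖ∂ₗ = ∂ₗ∂ₖ`,
`pderiv_comm`) and moving a derivative through a word (`pderiv_ipderiv`); the recursion
`|∇^{m+1} f|² = ∑ₗ |∇ᵐ ∂ₗ f|²` (`dnormSq_succ`); `|∂^α f| ≤ |∇ᵐ f|`, `|∇ᵐ ∂ₗ f| ≤ |∇^{m+1} f|`,
`|∇ᵐ ∂^α f| ≤ |∇^{m+n} f|`; triangle inequalities; the **exact Leibniz formula**
`∂^γ (f g) = ∑_b ∂^{γ,b} f · ∂^{γ,¬b} g` over masks (`ipderiv_mul`) and the **remainder bound**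
`|∂^γ (f g) − f ∂^γ g| ≤ 2^m ∑_{a=1}^{m} |∇ᵃ f| |∇^{m-a} g|` (`abs_ipderiv_mul_sub_mul_ipderiv_le`,
no binomial bookkeeping); the comparison with Mathlib's Fréchet tensor:
`∂^α f (x) = iteratedFDeriv ℝ m f x (e ∘ α)` (`ipderiv_eq_iteratedFDeriv`), whence
`|∇ᵐ f|² ≤ (card ι)^m ‖Dᵐ f‖²` and `‖Dᵐ f‖² ≤ (card ι)^m |∇ᵐ f|²`; for maps into `ℝ^κ`,
`‖Dᵐ u_c‖ ≤ ‖Dᵐ u‖ ≤ ∑_c ‖Dᵐ u_c‖`; and for bundled families `‖D(famVec g)(x)‖² ≤ ∑ₗ ∑_c (∂ₗ g_c)²`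
(operator norm versus Frobenius norm, `sq_opNorm_le_sum_sq_norm_apply_stdVec`).

## Mathlib / tree search

Mathlib (this pin) has `iteratedFDeriv`, `iteratedDeriv` (one variable), `lineDeriv`, the
symmetric second derivative (`IsSymmSndFDerivAt`) and norm bounds for derivatives of products
(`norm_iteratedFDeriv_mul_le`, binomial form, operator norms); it has no coordinate partial
derivative operator on `EuclideanSpace` nor the sum-of-squares tensor norm;
`pderiv l f x` is literally `fderiv ℝ f x (EuclideanSpace.single l 1)` and `stdVec l` is
`EuclideanSpace.basisFun ι ℝ l` (`stdVec_eq_basisFun`).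

Tree: `Literature.Analysis.FluidPDE.VectorCalculus` (same namespace `Literature.Fluid`) already has the
**first-order, coordinate-free** layer — `partialDeriv e v x = Dv(x) e`, `divergence`,
`IsDivFree`, the Frobenius norm `frobeniusNormSq`, the spin matrix `spin v x = Dv − Dvᵀ` and
`curl` on `ℝ³` — and this file does **not** introduce a competing vocabulary for it: `pderiv l f`
is *definitionally* `partialDeriv (stdVec l) f` (`pderiv_eq_partialDeriv`, `rfl`), and the final
section `Bridges` proves the order-`0`/`1` identifications `∂ₗvᵢ = (partialDeriv eₗ v)ᵢ`,
`div v = ∑ᵢ ∂ᵢvᵢ` (so `IsDivFree v ↔ ∀ x, ∑ᵢ ∂ᵢvᵢ(x) = 0` for differentiable `v`: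
`IsDivFree.sum_pderiv_comp_eq_zero`, `isDivFree_of_sum_pderiv_comp_eq_zero`),
`levelSq 1 v x = frobeniusNormSq (fderiv ℝ v x)`, `vortComp v k i x = spin v x eₖ i` and
`vortSq 0 v x = frobeniusNormSq (spin v x)` (`= 2‖curl v x‖²` on `ℝ³`,
`VectorCalculus.norm_curl_sq_eq_frobeniusNormSq_spin`). What is new here is the
**higher-order coordinate calculus** (words `∂^α`, the tensors `|∇ᵐf|²`, Leibniz over masks, the
comparison with `iteratedFDeriv`), which `VectorCalculus` does not address and which the energy
method needs at every derivative level with the Hilbert (sum-of-squares) structure.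

## References

* A. J. Majda, A. L. Bertozzi, *Vorticity and Incompressible Flow*, CUP (2002)
  (`MajdaBertozzi2002`), §3.2.1: the `H^m` norm as the sum over multi-indices
  `‖v‖ₘ² = ∑_{|α| ≤ m} ‖D^α v‖₀²`, `D^α = ∂₁^{α₁} ⋯ ∂_N^{α_N}` (eq. (3.28); held copy p. 85), and
  the Leibniz-type calculus inequalities of Lemma 3.4 (held copy pp. 85–86). [folklore]
* C. R. Doering, J. D. Gibbon, *Applied Analysis of the Navier–Stokes Equations*, CUP (1995)
  (`DoeringGibbon1995`), §6.1, eq. (6.1.2) (held copy p. 96): `|Dᴺu|²` = the sum of the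
  squares of *every* derivative of order `N` (ordered words: "the xx, xy, yx, and yy
  derivatives"), the convention of `dnormSq`/`levelSq` below. [folklore]
* L. C. Evans, *Partial Differential Equations*, 2nd ed., AMS (2010) (`Evans2010`), Appendix A
  (notation for multi-indices and partial derivatives). [folklore]
-/

noncomputable section

open scoped BigOperators ContDiff
open Finset Function

namespace Literature.Analysis.FluidPDE

variable {ι : Type*} [Fintype ι] [DecidableEq ι]

/-- Local notation for the Euclidean space `ℝ^ι`. -/
local notation "𝔼" => EuclideanSpace ℝ ι

/-! ### First-order coordinate partial derivatives -/

/-- The standard basis vector `eₗ` of `EuclideanSpace ℝ ι`; equal to Mathlib's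
`EuclideanSpace.basisFun ι ℝ l` (`stdVec_eq_basisFun`, so that `frobeniusNormSq_eq_sum
(EuclideanSpace.basisFun ι ℝ)` rewrites directly), kept as a short abbreviation. [folklore] -/
abbrev stdVec (l : ι) : 𝔼 := EuclideanSpace.single l 1

omit [Fintype ι] in
/-- Components of the standard basis vector `eₗ`. [folklore] -/
@[simp]
theorem stdVec_apply (l j : ι) : (stdVec l : 𝔼) j = if j = l then 1 else 0 := by
  simp [stdVec]

/-- The coordinate partial derivative `∂ₗ f (x) = Df(x) eₗ` of a scalar function (junk `0` where
`f` is not differentiable, inherited from `fderiv`). This is *definitionally* the tree's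
directional derivative `Fluid.partialDeriv (stdVec l) f` of `VectorCalculus`
(`pderiv_eq_partialDeriv : pderiv l f = partialDeriv (stdVec l) f := rfl`); the short scalar form
is kept because the word derivatives `ipderiv` below iterate it hundreds of times. [folklore] -/
def pderiv (l : ι) (f : 𝔼 → ℝ) (x : 𝔼) : ℝ :=
  fderiv ℝ f x (stdVec l)

omit [Fintype ι] in
/-- Unfolding `∂ₗ f (x) = Df(x) eₗ`. [folklore] -/
theorem pderiv_apply (l : ι) (f : 𝔼 → ℝ) (x : 𝔼) : pderiv l f x = fderiv ℝ f x (stdVec l) := rfl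

omit [Fintype ι] in
/-- `∂ₗ f` as a function. [folklore] -/
theorem pderiv_eq (l : ι) (f : 𝔼 → ℝ) : pderiv l f = fun x => (fderiv ℝ f x) (stdVec l) := rfl

/-- `∂ₗ` of a smooth function is smooth. [folklore] -/
theorem contDiff_pderiv {f : 𝔼 → ℝ} (hf : ContDiff ℝ ∞ f) (l : ι) : ContDiff ℝ ∞ (pderiv l f) := by
  have h := (contDiff_infty_iff_fderiv.1 hf).2
  exact h.clm_apply contDiff_const

/-- `∂ₗ (f + g) = ∂ₗ f + ∂ₗ g`. [folklore] -/
theorem pderiv_add {f g : 𝔼 → ℝ} (hf : Differentiable ℝ f) (hg : Differentiable ℝ g) (l : ι) :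
    pderiv l (fun x => f x + g x) = fun x => pderiv l f x + pderiv l g x := by
  funext x
  simp only [pderiv]
  rw [fderiv_fun_add (hf x) (hg x)]
  rfl

/-- `∂ₗ (f - g) = ∂ₗ f - ∂ₗ g`. [folklore] -/
theorem pderiv_sub {f g : 𝔼 → ℝ} (hf : Differentiable ℝ f) (hg : Differentiable ℝ g) (l : ι) :
    pderiv l (fun x => f x - g x) = fun x => pderiv l f x - pderiv l g x := by
  funext x
  simp only [pderiv]
  rw [fderiv_fun_sub (hf x) (hg x)]
  rfl

/-- `∂ₗ (-f) = -∂ₗ f`. [folklore] -/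
theorem pderiv_neg (f : 𝔼 → ℝ) (l : ι) : pderiv l (fun x => -f x) = fun x => -pderiv l f x := by
  funext x
  simp only [pderiv]
  rw [fderiv_fun_neg]
  rfl

/-- `∂ₗ (c f) = c ∂ₗ f`. [folklore] -/
theorem pderiv_const_mul {f : 𝔼 → ℝ} (hf : Differentiable ℝ f) (c : ℝ) (l : ι) :
    pderiv l (fun x => c * f x) = fun x => c * pderiv l f x := by
  funext x
  simp only [pderiv]
  rw [fderiv_const_mul (hf x)]
  rfl

omit [Fintype ι] in
/-- Constants have vanishing partial derivatives. [folklore] -/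
theorem pderiv_const (c : ℝ) (l : ι) : pderiv l (fun _ : 𝔼 => c) = fun _ => 0 := by
  funext x
  simp [pderiv]

/-- Leibniz rule for `∂ₗ`. [folklore] -/
theorem pderiv_mul {f g : 𝔼 → ℝ} (hf : Differentiable ℝ f) (hg : Differentiable ℝ g) (l : ι) :
    pderiv l (fun x => f x * g x) = fun x => pderiv l f x * g x + f x * pderiv l g x := by
  funext x
  simp only [pderiv]
  rw [fderiv_fun_mul (hf x) (hg x)]
  simp only [add_apply, FunLike.coe_smul, Pi.smul_apply,
    smul_eq_mul]
  ring

/-- `∂ₗ` of a finite sum. [folklore] -/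
theorem pderiv_sum {κ : Type*} (s : Finset κ) {f : κ → 𝔼 → ℝ} (hf : ∀ k ∈ s, Differentiable ℝ (f k))
    (l : ι) : pderiv l (fun x => ∑ k ∈ s, f k x) = fun x => ∑ k ∈ s, pderiv l (f k) x := by
  funext x
  simp only [pderiv]
  rw [fderiv_fun_sum fun k hk => hf k hk x]
  simp

/-- `∂ₗ (f^{k+1}) = (k+1) f^k ∂ₗ f`. [folklore] -/
theorem pderiv_pow {f : 𝔼 → ℝ} (hf : Differentiable ℝ f) (k : ℕ) (l : ι) :
    pderiv l (fun x => f x ^ (k + 1)) = fun x => (k + 1) * f x ^ k * pderiv l f x := by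
  induction k with
  | zero =>
      funext x
      simp [pderiv]
  | succ k ih =>
      have hfk : Differentiable ℝ fun x => f x ^ (k + 1) := hf.pow _
      have : (fun x => f x ^ (k + 1 + 1)) = fun x => f x ^ (k + 1) * f x := by
        funext x; ring
      rw [this, pderiv_mul hfk hf, ih]
      funext x
      push_cast
      ring

/-- `|∂ₗ f (x)| ≤ ‖Df(x)‖` (`eₗ` is a unit vector). [folklore] -/
theorem abs_pderiv_le_norm_fderiv (l : ι) (f : 𝔼 → ℝ) (x : 𝔼) :
    |pderiv l f x| ≤ ‖fderiv ℝ f x‖ := by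
  rw [pderiv_apply, ← Real.norm_eq_abs]
  refine (ContinuousLinearMap.le_opNorm _ _).trans ?_
  simp [stdVec]

/-- `∑ₗ (∂ₗ f (x))² ≤ (card ι) ‖Df(x)‖²`. [folklore] -/
theorem sum_sq_pderiv_le (f : 𝔼 → ℝ) (x : 𝔼) :
    ∑ l, pderiv l f x ^ 2 ≤ Fintype.card ι * ‖fderiv ℝ f x‖ ^ 2 := by
  calc ∑ l, pderiv l f x ^ 2 ≤ ∑ _l : ι, ‖fderiv ℝ f x‖ ^ 2 := sum_le_sum fun l _ => by
        rw [← sq_abs]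
        exact pow_le_pow_left₀ (abs_nonneg _) (abs_pderiv_le_norm_fderiv l f x) 2
    _ = Fintype.card ι * ‖fderiv ℝ f x‖ ^ 2 := by simp

/-- `∂ₗ f` of a `C¹` function is continuous. [folklore] -/
theorem continuous_pderiv {f : 𝔼 → ℝ} {n : WithTop ℕ∞} (hf : ContDiff ℝ n f) (hn : n ≠ 0) (l : ι) :
    Continuous (pderiv l f) :=
  (hf.continuous_fderiv hn).clm_apply continuous_const

/-- **Schwarz**: partial derivatives of a smooth function commute. [folklore] -/
theorem pderiv_comm {f : 𝔼 → ℝ} (hf : ContDiff ℝ ∞ f) (k l : ι) :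
    pderiv k (pderiv l f) = pderiv l (pderiv k f) := by
  funext x
  have hd : DifferentiableAt ℝ (fderiv ℝ f) x :=
    ((contDiff_infty_iff_fderiv.1 hf).2.differentiable (by simp)) x
  have hsymm : IsSymmSndFDerivAt ℝ f x :=
    hf.contDiffAt.isSymmSndFDerivAt (by
      rw [minSmoothness_of_isRCLikeNormedField]; exact WithTop.coe_le_coe.2 le_top)
  rw [pderiv_apply, pderiv_apply, pderiv_eq l, pderiv_eq k,
    fderiv_clm_apply hd (differentiableAt_const _), fderiv_clm_apply hd (differentiableAt_const _)]
  simp only [fderiv_fun_const, Pi.zero_apply, ContinuousLinearMap.comp_zero, zero_add,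
    ContinuousLinearMap.flip_apply]
  exact hsymm _ _

/-! ### Iterated coordinate partial derivatives along words -/

/-- The iterated partial derivative `∂^α f = ∂_{α 0} (∂_{α 1} ( ⋯ (∂_{α (m-1)} f)))` along a word
`α : Fin m → ι` (outermost derivative first). [folklore] -/
def ipderiv : {m : ℕ} → (Fin m → ι) → (𝔼 → ℝ) → 𝔼 → ℝ
  | 0, _, f => f
  | _ + 1, α, f => pderiv (α 0) (ipderiv (Fin.tail α) f)

omit [Fintype ι] in
/-- The empty word does nothing. [folklore] -/
@[simp]
theorem ipderiv_zero (α : Fin 0 → ι) (f : 𝔼 → ℝ) : ipderiv α f = f := rfl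

omit [Fintype ι] in
/-- Unfolding one letter of a word derivative (outermost first). [folklore] -/
theorem ipderiv_succ {m : ℕ} (α : Fin (m + 1) → ι) (f : 𝔼 → ℝ) :
    ipderiv α f = pderiv (α 0) (ipderiv (Fin.tail α) f) := rfl

omit [Fintype ι] in
/-- `∂^{l :: β} f = ∂ₗ ∂^β f`. [folklore] -/
@[simp]
theorem ipderiv_cons {m : ℕ} (l : ι) (β : Fin m → ι) (f : 𝔼 → ℝ) :
    ipderiv (Fin.cons l β : Fin (m + 1) → ι) f = pderiv l (ipderiv β f) := by
  rw [ipderiv_succ]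
  simp

/-- Iterated partial derivatives of a smooth function are smooth. [folklore] -/
theorem contDiff_ipderiv {f : 𝔼 → ℝ} (hf : ContDiff ℝ ∞ f) :
    ∀ {m : ℕ} (α : Fin m → ι), ContDiff ℝ ∞ (ipderiv α f)
  | 0, _ => hf
  | _ + 1, α => contDiff_pderiv (contDiff_ipderiv hf (Fin.tail α)) (α 0)

/-- Moving one partial derivative through a word: `∂ₗ ∂^α f = ∂^α ∂ₗ f`. [folklore] -/
theorem pderiv_ipderiv {f : 𝔼 → ℝ} (hf : ContDiff ℝ ∞ f) (l : ι) :
    ∀ {m : ℕ} (α : Fin m → ι), pderiv l (ipderiv α f) = ipderiv α (pderiv l f)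
  | 0, _ => rfl
  | m + 1, α => by
      rw [ipderiv_succ, ipderiv_succ, pderiv_comm (contDiff_ipderiv hf _), pderiv_ipderiv hf l (Fin.tail α)]

/-- Adding a derivative innermost equals adding it outermost: `∂^α (∂ₗ f) = ∂ₗ (∂^α f)`. [folklore] -/
theorem ipderiv_pderiv {f : 𝔼 → ℝ} (hf : ContDiff ℝ ∞ f) (l : ι) {m : ℕ} (α : Fin m → ι) :
    ipderiv α (pderiv l f) = pderiv l (ipderiv α f) :=
  (pderiv_ipderiv hf l α).symm

/-- `∂^α (f + g) = ∂^α f + ∂^α g`. [folklore] -/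
theorem ipderiv_add {f g : 𝔼 → ℝ} (hf : ContDiff ℝ ∞ f) (hg : ContDiff ℝ ∞ g) :
    ∀ {m : ℕ} (α : Fin m → ι),
      ipderiv α (fun x => f x + g x) = fun x => ipderiv α f x + ipderiv α g x
  | 0, _ => rfl
  | m + 1, α => by
      rw [ipderiv_succ, ipderiv_add hf hg (Fin.tail α),
        pderiv_add ((contDiff_ipderiv hf _).differentiable (by simp))
          ((contDiff_ipderiv hg _).differentiable (by simp))]
      rfl

/-- `∂^α (f - g) = ∂^α f - ∂^α g`. [folklore] -/
theorem ipderiv_sub {f g : 𝔼 → ℝ} (hf : ContDiff ℝ ∞ f) (hg : ContDiff ℝ ∞ g) :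
    ∀ {m : ℕ} (α : Fin m → ι),
      ipderiv α (fun x => f x - g x) = fun x => ipderiv α f x - ipderiv α g x
  | 0, _ => rfl
  | m + 1, α => by
      rw [ipderiv_succ, ipderiv_sub hf hg (Fin.tail α),
        pderiv_sub ((contDiff_ipderiv hf _).differentiable (by simp))
          ((contDiff_ipderiv hg _).differentiable (by simp))]
      rfl

/-- `∂^α (c f) = c ∂^α f`. [folklore] -/
theorem ipderiv_const_mul {f : 𝔼 → ℝ} (hf : ContDiff ℝ ∞ f) (c : ℝ) :
    ∀ {m : ℕ} (α : Fin m → ι), ipderiv α (fun x => c * f x) = fun x => c * ipderiv α f x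
  | 0, _ => rfl
  | m + 1, α => by
      rw [ipderiv_succ, ipderiv_const_mul hf c (Fin.tail α),
        pderiv_const_mul ((contDiff_ipderiv hf _).differentiable (by simp))]
      rfl

/-- `∂^α (-f) = -∂^α f`. [folklore] -/
theorem ipderiv_neg {f : 𝔼 → ℝ} (hf : ContDiff ℝ ∞ f) {m : ℕ} (α : Fin m → ι) :
    ipderiv α (fun x => -f x) = fun x => -ipderiv α f x := by
  have := ipderiv_const_mul hf (-1) α
  simp only [neg_mul, one_mul] at this
  exact this

/-- Iterated partial derivatives of a smooth function are continuous. [folklore] -/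
theorem continuous_ipderiv {f : 𝔼 → ℝ} (hf : ContDiff ℝ ∞ f) {m : ℕ} (α : Fin m → ι) :
    Continuous (ipderiv α f) :=
  (contDiff_ipderiv hf α).continuous

/-- `∂^α` of a finite sum of smooth functions. [folklore] -/
theorem ipderiv_finset_sum {κ : Type*} (s : Finset κ) {f : κ → 𝔼 → ℝ}
    (hf : ∀ k, ContDiff ℝ ∞ (f k)) :
    ∀ {m : ℕ} (α : Fin m → ι),
      ipderiv α (fun x => ∑ k ∈ s, f k x) = fun x => ∑ k ∈ s, ipderiv α (f k) x
  | 0, _ => rfl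
  | m + 1, α => by
      rw [ipderiv_succ, ipderiv_finset_sum s hf (Fin.tail α),
        pderiv_sum (f := fun k y => ipderiv (Fin.tail α) (f k) y) s
          (fun k _ => (contDiff_ipderiv (hf k) _).differentiable (by simp))]
      rfl

/-- `∂^α 0 = 0`. [folklore] -/
theorem ipderiv_zero_fun {m : ℕ} (α : Fin m → ι) : ipderiv α (fun _ : 𝔼 => (0 : ℝ)) = fun _ => 0 := by
  have := ipderiv_const_mul (contDiff_const (c := (0 : ℝ))) 0 α
  simp only [zero_mul] at this
  exact this

/-! ### Sums over words -/

omit [Fintype ι] [DecidableEq ι] in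
/-- Splitting a sum over words of length `m + 1` (letters in any finite alphabet `κ`) according
to the first letter. [folklore] -/
theorem sum_word_succ {κ : Type*} [Fintype κ] {M : Type*} [AddCommMonoid M] {m : ℕ}
    (F : (Fin (m + 1) → κ) → M) :
    ∑ α, F α = ∑ l : κ, ∑ β : Fin m → κ, F (Fin.cons l β) := by
  rw [← Fintype.sum_prod_type']
  exact (Fintype.sum_equiv (Fin.consEquiv fun _ => κ) _ _ fun p => rfl).symm

/-! ### The coordinate norm of the `m`-th derivative -/

/-- `dnormSq m f x = ∑_{|α| = m} (∂^α f (x))²`, the squared Euclidean norm of the coordinate tensor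
`∇ᵐ f (x)`. [folklore] -/
def dnormSq (m : ℕ) (f : 𝔼 → ℝ) (x : 𝔼) : ℝ :=
  ∑ α : Fin m → ι, ipderiv α f x ^ 2

/-- `dnorm m f x = (∑_{|α| = m} (∂^α f (x))²)^{1/2} = |∇ᵐ f (x)|`. [folklore] -/
def dnorm (m : ℕ) (f : 𝔼 → ℝ) (x : 𝔼) : ℝ :=
  Real.sqrt (dnormSq m f x)

/-- `0 ≤ |∇ᵐ f|²`. [folklore] -/
theorem dnormSq_nonneg (m : ℕ) (f : 𝔼 → ℝ) (x : 𝔼) : 0 ≤ dnormSq m f x :=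
  sum_nonneg fun _ _ => sq_nonneg _

/-- `0 ≤ |∇ᵐ f|`. [folklore] -/
theorem dnorm_nonneg (m : ℕ) (f : 𝔼 → ℝ) (x : 𝔼) : 0 ≤ dnorm m f x := Real.sqrt_nonneg _

/-- `|∇ᵐ f|² = dnormSq m f`. [folklore] -/
theorem dnorm_sq (m : ℕ) (f : 𝔼 → ℝ) (x : 𝔼) : dnorm m f x ^ 2 = dnormSq m f x :=
  Real.sq_sqrt (dnormSq_nonneg m f x)

/-- `|∇⁰ f|² = f²`. [folklore] -/
@[simp]
theorem dnormSq_zero (f : 𝔼 → ℝ) (x : 𝔼) : dnormSq 0 f x = f x ^ 2 := by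
  simp [dnormSq]

/-- `|∇⁰ f| = |f|`. [folklore] -/
@[simp]
theorem dnorm_zero (f : 𝔼 → ℝ) (x : 𝔼) : dnorm 0 f x = |f x| := by
  simp [dnorm, Real.sqrt_sq_eq_abs]

/-- `x ↦ |∇ᵐ f (x)|²` is continuous for smooth `f`. [folklore] -/
theorem continuous_dnormSq {f : 𝔼 → ℝ} (hf : ContDiff ℝ ∞ f) (m : ℕ) :
    Continuous (dnormSq m f) := by
  unfold dnormSq
  exact continuous_finsetSum _ fun α _ => (continuous_ipderiv hf α).pow 2

/-- `x ↦ |∇ᵐ f (x)|` is continuous for smooth `f`. [folklore] -/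
theorem continuous_dnorm {f : 𝔼 → ℝ} (hf : ContDiff ℝ ∞ f) (m : ℕ) : Continuous (dnorm m f) :=
  Real.continuous_sqrt.comp (continuous_dnormSq hf m)

/-- `x ↦ |∇ᵐ f (x)|²` is smooth for smooth `f`. [folklore] -/
theorem contDiff_dnormSq {f : 𝔼 → ℝ} (hf : ContDiff ℝ ∞ f) (m : ℕ) :
    ContDiff ℝ ∞ (dnormSq m f) := by
  unfold dnormSq
  exact ContDiff.sum fun α _ => (contDiff_ipderiv hf α).pow 2

/-- The tuple `(∂^α f (x))_α` as a vector of the Euclidean space indexed by words, so that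
`dnorm m f x` is its norm. [folklore] -/
def dvec (m : ℕ) (f : 𝔼 → ℝ) (x : 𝔼) : EuclideanSpace ℝ (Fin m → ι) :=
  WithLp.toLp 2 fun α => ipderiv α f x

omit [Fintype ι] in
/-- Components of `dvec`. [folklore] -/
@[simp]
theorem dvec_apply (m : ℕ) (f : 𝔼 → ℝ) (x : 𝔼) (α : Fin m → ι) : dvec m f x α = ipderiv α f x := rfl

/-- `‖dvec m f x‖ = |∇ᵐ f (x)|`. [folklore] -/
theorem norm_dvec (m : ℕ) (f : 𝔼 → ℝ) (x : 𝔼) : ‖dvec m f x‖ = dnorm m f x := by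
  rw [EuclideanSpace.norm_eq, dnorm, dnormSq]
  simp [dvec_apply, sq_abs]

/-- Recursion outermost-first: `|∇^{m+1} f|² = ∑ₗ ∑_β (∂ₗ ∂^β f)²`. [folklore] -/
theorem dnormSq_succ_eq_sum_cons (m : ℕ) (f : 𝔼 → ℝ) (x : 𝔼) :
    dnormSq (m + 1) f x = ∑ l : ι, ∑ β : Fin m → ι, pderiv l (ipderiv β f) x ^ 2 := by
  rw [dnormSq, sum_word_succ]
  simp

/-- Recursion innermost-first (Schwarz): `|∇^{m+1} f|² = ∑ₗ |∇^m (∂ₗ f)|²`. [folklore] -/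
theorem dnormSq_succ {f : 𝔼 → ℝ} (hf : ContDiff ℝ ∞ f) (m : ℕ) (x : 𝔼) :
    dnormSq (m + 1) f x = ∑ l : ι, dnormSq m (pderiv l f) x := by
  rw [dnormSq_succ_eq_sum_cons]
  refine sum_congr rfl fun l _ => sum_congr rfl fun β _ => ?_
  rw [pderiv_ipderiv hf]

/-- A single component is bounded by the norm: `|∂^α f (x)| ≤ |∇^m f (x)|`. [folklore] -/
theorem abs_ipderiv_le_dnorm {m : ℕ} (α : Fin m → ι) (f : 𝔼 → ℝ) (x : 𝔼) :
    |ipderiv α f x| ≤ dnorm m f x := by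
  rw [← norm_dvec, ← Real.norm_eq_abs, ← dvec_apply]
  exact PiLp.norm_apply_le (dvec m f x) α

/-- `|∇^m (∂ₗ f)| ≤ |∇^{m+1} f|`. [folklore] -/
theorem dnorm_pderiv_le {f : 𝔼 → ℝ} (hf : ContDiff ℝ ∞ f) (m : ℕ) (l : ι) (x : 𝔼) :
    dnorm m (pderiv l f) x ≤ dnorm (m + 1) f x := by
  rw [dnorm, dnorm]
  apply Real.sqrt_le_sqrt
  rw [dnormSq_succ hf]
  exact single_le_sum (f := fun l => dnormSq m (pderiv l f) x) (fun _ _ => dnormSq_nonneg _ _ _)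
    (mem_univ l)

/-- `|∇^m (∂^α f)| ≤ |∇^{m+n} f|` for a word of length `n`. [folklore] -/
theorem dnorm_ipderiv_le {f : 𝔼 → ℝ} (hf : ContDiff ℝ ∞ f) (m : ℕ) :
    ∀ {n : ℕ} (α : Fin n → ι) (x : 𝔼), dnorm m (ipderiv α f) x ≤ dnorm (m + n) f x
  | 0, _, _ => le_rfl
  | n + 1, α, x => by
      rw [ipderiv_succ, pderiv_ipderiv hf]
      calc dnorm m (ipderiv (Fin.tail α) (pderiv (α 0) f)) x
          ≤ dnorm (m + n) (pderiv (α 0) f) x := dnorm_ipderiv_le (contDiff_pderiv hf _) m (Fin.tail α) x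
        _ ≤ dnorm (m + n + 1) f x := dnorm_pderiv_le hf _ _ _

/-- `dvec` is additive. [folklore] -/
theorem dvec_add {f g : 𝔼 → ℝ} (hf : ContDiff ℝ ∞ f) (hg : ContDiff ℝ ∞ g) (m : ℕ) (x : 𝔼) :
    dvec m (fun y => f y + g y) x = dvec m f x + dvec m g x := by
  ext α
  simp [dvec_apply, ipderiv_add hf hg]

/-- `dvec` is homogeneous. [folklore] -/
theorem dvec_const_mul {f : 𝔼 → ℝ} (hf : ContDiff ℝ ∞ f) (c : ℝ) (m : ℕ) (x : 𝔼) :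
    dvec m (fun y => c * f y) x = c • dvec m f x := by
  ext α
  simp [dvec_apply, ipderiv_const_mul hf]

/-- Triangle inequality for the coordinate norm. [folklore] -/
theorem dnorm_add_le {f g : 𝔼 → ℝ} (hf : ContDiff ℝ ∞ f) (hg : ContDiff ℝ ∞ g) (m : ℕ) (x : 𝔼) :
    dnorm m (fun y => f y + g y) x ≤ dnorm m f x + dnorm m g x := by
  rw [← norm_dvec, ← norm_dvec, ← norm_dvec, dvec_add hf hg]
  exact norm_add_le _ _

/-- Triangle inequality for the coordinate norm (difference). [folklore] -/
theorem dnorm_sub_le {f g : 𝔼 → ℝ} (hf : ContDiff ℝ ∞ f) (hg : ContDiff ℝ ∞ g) (m : ℕ) (x : 𝔼) :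
    dnorm m (fun y => f y - g y) x ≤ dnorm m f x + dnorm m g x := by
  have h := dnorm_add_le hf (hg.neg) m x
  have e1 : (fun y => f y + -g y) = fun y => f y - g y := by funext y; ring
  rw [e1] at h
  refine h.trans (add_le_add le_rfl (le_of_eq ?_))
  rw [← norm_dvec, ← norm_dvec, show (fun y => -g y) = fun y => (-1) * g y by funext; ring,
    dvec_const_mul hg, norm_smul]
  simp

/-- `|∇ᵐ (c f)| = |c| |∇ᵐ f|`. [folklore] -/
theorem dnorm_const_mul {f : 𝔼 → ℝ} (hf : ContDiff ℝ ∞ f) (c : ℝ) (m : ℕ) (x : 𝔼) :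
    dnorm m (fun y => c * f y) x = |c| * dnorm m f x := by
  rw [← norm_dvec, ← norm_dvec, dvec_const_mul hf, norm_smul, Real.norm_eq_abs]

/-- `|∇ᵐ (-f)| = |∇ᵐ f|`. [folklore] -/
theorem dnorm_neg {f : 𝔼 → ℝ} (hf : ContDiff ℝ ∞ f) (m : ℕ) (x : 𝔼) :
    dnorm m (fun y => -f y) x = dnorm m f x := by
  rw [show (fun y => -f y) = fun y => (-1) * f y by funext; ring, dnorm_const_mul hf]
  simp

/-- Coordinate norm of a finite sum. [folklore] -/
theorem dnorm_sum_le {κ : Type*} (s : Finset κ) {f : κ → 𝔼 → ℝ} (hf : ∀ k, ContDiff ℝ ∞ (f k))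
    (m : ℕ) (x : 𝔼) : dnorm m (fun y => ∑ k ∈ s, f k y) x ≤ ∑ k ∈ s, dnorm m (f k) x := by
  classical
  induction s using Finset.induction_on with
  | empty =>
      simp only [sum_empty]
      rw [← norm_dvec]
      have : dvec m (fun _ : 𝔼 => (0 : ℝ)) x = 0 := by
        ext α
        simp only [dvec_apply, PiLp.zero_apply]
        have := ipderiv_const_mul (contDiff_const (c := (0 : ℝ))) 0 α
        simp only [zero_mul] at this
        exact congrFun this x
      simp [this]
  | insert k s hk ih =>
      simp only [sum_insert hk]
      exact (dnorm_add_le (hf k) (ContDiff.sum fun j _ => hf j) m x).trans (add_le_add le_rfl ih)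

/-! ### Leibniz: the exact product formula over sub-words, and norm bounds -/

/-- The partial derivative along the sub-word of `γ : Fin m → ι` selected by a mask
`b : Fin m → Bool`: apply `∂_{γ j}` exactly for those `j` with `b j = true` (outermost first).
[folklore] -/
def ipderivSub : {m : ℕ} → (Fin m → ι) → (Fin m → Bool) → (𝔼 → ℝ) → 𝔼 → ℝ
  | 0, _, _, f => f
  | _ + 1, γ, b, f =>
      if b 0 = true then pderiv (γ 0) (ipderivSub (Fin.tail γ) (Fin.tail b) f)
      else ipderivSub (Fin.tail γ) (Fin.tail b) f

omit [Fintype ι] in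
/-- The empty mask does nothing. [folklore] -/
@[simp]
theorem ipderivSub_zero (γ : Fin 0 → ι) (b : Fin 0 → Bool) (f : 𝔼 → ℝ) : ipderivSub γ b f = f := rfl

omit [Fintype ι] in
/-- Unfolding one letter of a masked word derivative. [folklore] -/
theorem ipderivSub_succ {m : ℕ} (γ : Fin (m + 1) → ι) (b : Fin (m + 1) → Bool) (f : 𝔼 → ℝ) :
    ipderivSub γ b f =
      if b 0 = true then pderiv (γ 0) (ipderivSub (Fin.tail γ) (Fin.tail b) f)
      else ipderivSub (Fin.tail γ) (Fin.tail b) f := rfl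

omit [Fintype ι] in
/-- A mask starting with `true` differentiates in the first letter. [folklore] -/
@[simp]
theorem ipderivSub_cons_true {m : ℕ} (γ : Fin (m + 1) → ι) (b : Fin m → Bool) (f : 𝔼 → ℝ) :
    ipderivSub γ (Fin.cons true b : Fin (m + 1) → Bool) f =
      pderiv (γ 0) (ipderivSub (Fin.tail γ) b f) := by
  rw [ipderivSub_succ]
  simp

omit [Fintype ι] in
/-- A mask starting with `false` skips the first letter. [folklore] -/
@[simp]
theorem ipderivSub_cons_false {m : ℕ} (γ : Fin (m + 1) → ι) (b : Fin m → Bool) (f : 𝔼 → ℝ) :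
    ipderivSub γ (Fin.cons false b : Fin (m + 1) → Bool) f = ipderivSub (Fin.tail γ) b f := by
  rw [ipderivSub_succ]
  simp

/-- Masked derivatives of a smooth function are smooth. [folklore] -/
theorem contDiff_ipderivSub {f : 𝔼 → ℝ} (hf : ContDiff ℝ ∞ f) :
    ∀ {m : ℕ} (γ : Fin m → ι) (b : Fin m → Bool), ContDiff ℝ ∞ (ipderivSub γ b f)
  | 0, _, _ => hf
  | m + 1, γ, b => by
      rw [ipderivSub_succ]
      split_ifs
      · exact contDiff_pderiv (contDiff_ipderivSub hf _ _) _
      · exact contDiff_ipderivSub hf _ _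

omit [Fintype ι] in
/-- The all-true mask gives the full word derivative. [folklore] -/
theorem ipderivSub_true : ∀ {m : ℕ} (γ : Fin m → ι) (f : 𝔼 → ℝ),
    ipderivSub γ (fun _ => true) f = ipderiv γ f
  | 0, _, _ => rfl
  | m + 1, γ, f => by
      rw [ipderivSub_succ, ipderiv_succ]
      simp only [if_true]
      congr 1
      exact ipderivSub_true (Fin.tail γ) f

omit [Fintype ι] in
/-- The all-false mask does nothing. [folklore] -/
theorem ipderivSub_false : ∀ {m : ℕ} (γ : Fin m → ι) (f : 𝔼 → ℝ),
    ipderivSub γ (fun _ => false) f = f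
  | 0, _, _ => rfl
  | m + 1, γ, f => by
      rw [ipderivSub_succ]
      simp only [Bool.false_eq_true, if_false]
      exact ipderivSub_false (Fin.tail γ) f

/-- The number of letters selected by a mask. [folklore] -/
def maskCard {m : ℕ} (b : Fin m → Bool) : ℕ := (univ.filter fun j => b j = true).card

/-- A mask selects at most `m` letters. [folklore] -/
theorem maskCard_le {m : ℕ} (b : Fin m → Bool) : maskCard b ≤ m := by
  unfold maskCard
  exact (card_filter_le _ _).trans (by simp)

/-- The empty mask selects no letter. [folklore] -/
@[simp]
theorem maskCard_fin_zero (b : Fin 0 → Bool) : maskCard b = 0 := by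
  simp [maskCard]

/-- Selected letters of `β :: b`. [folklore] -/
theorem maskCard_cons {m : ℕ} (β : Bool) (b : Fin m → Bool) :
    maskCard (Fin.cons β b : Fin (m + 1) → Bool) = (if β = true then 1 else 0) + maskCard b := by
  unfold maskCard
  rw [Fin.univ_succ, filter_cons]
  simp only [Fin.cons_zero]
  have hmap : (univ.map ⟨Fin.succ, Fin.succ_injective _⟩).filter
      (fun j : Fin (m + 1) => (Fin.cons β b : Fin (m + 1) → Bool) j = true) =
      (univ.filter fun j : Fin m => b j = true).map ⟨Fin.succ, Fin.succ_injective _⟩ := by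
    rw [filter_map]
    congr 1
  split_ifs with h
  · rw [card_cons, hmap, card_map, add_comm]
  · rw [hmap, card_map, zero_add]

/-- The complementary mask selects the complementary number of letters. [folklore] -/
theorem maskCard_not {m : ℕ} (b : Fin m → Bool) :
    maskCard (fun j => !b j) = m - maskCard b := by
  unfold maskCard
  have h := Finset.card_filter_add_card_filter_not (s := (univ : Finset (Fin m)))
    (p := fun j => b j = true)
  simp only [card_univ, Fintype.card_fin] at h
  have h2 : (univ.filter fun j : Fin m => (!b j) = true) = univ.filter fun j => ¬ b j = true := by
    congr 1
    ext j
    simp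
  rw [h2]
  omega

/-- A mask other than the empty one selects a letter. [folklore] -/
theorem maskCard_pos_of_ne {m : ℕ} {b : Fin m → Bool} (hb : b ≠ fun _ => false) : 0 < maskCard b := by
  unfold maskCard
  rw [card_pos]
  by_contra h
  rw [Finset.not_nonempty_iff_eq_empty, filter_eq_empty_iff] at h
  apply hb
  funext j
  simpa using h (mem_univ j)

omit [Fintype ι] in
/-- A masked derivative is an iterated derivative along a word of length `maskCard b`
(the selected sub-word). [folklore] -/
theorem exists_ipderivSub_eq : ∀ {m : ℕ} (γ : Fin m → ι) (b : Fin m → Bool),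
    ∃ w : Σ k, (Fin k → ι), w.1 = maskCard b ∧ ∀ f : 𝔼 → ℝ, ipderivSub γ b f = ipderiv w.2 f
  | 0, γ, b => ⟨⟨0, Fin.elim0⟩, by simp, fun f => rfl⟩
  | m + 1, γ, b => by
      obtain ⟨⟨k, γ'⟩, hk, h⟩ := exists_ipderivSub_eq (Fin.tail γ) (Fin.tail b)
      change k = maskCard (Fin.tail b) at hk
      have hb : b = Fin.cons (b 0) (Fin.tail b) := (Fin.cons_self_tail b).symm
      by_cases h0 : b 0 = true
      · refine ⟨⟨k + 1, Fin.cons (γ 0) γ'⟩, ?_, fun f => ?_⟩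
        · rw [hb, maskCard_cons, h0]
          simp only [if_true]
          omega
        · rw [ipderivSub_succ, if_pos h0, h f, ipderiv_cons]
      · refine ⟨⟨k, γ'⟩, ?_, fun f => ?_⟩
        · rw [hb, maskCard_cons, if_neg h0, zero_add]
          exact hk
        · rw [ipderivSub_succ, if_neg h0, h f]

/-- `|∂^{γ,b} f (x)| ≤ |∇^{|b|} f (x)|`. [folklore] -/
theorem abs_ipderivSub_le_dnorm {m : ℕ} (γ : Fin m → ι) (b : Fin m → Bool) (f : 𝔼 → ℝ) (x : 𝔼) :
    |ipderivSub γ b f x| ≤ dnorm (maskCard b) f x := by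
  obtain ⟨⟨k, γ'⟩, hk, h⟩ := exists_ipderivSub_eq γ b
  change k = maskCard b at hk
  subst hk
  rw [h f]
  exact abs_ipderiv_le_dnorm γ' f x

omit [Fintype ι] [DecidableEq ι] in
/-- Complement of a mask starting with `true`. [folklore] -/
theorem not_cons_true {m : ℕ} (b : Fin m → Bool) :
    (fun j => !(Fin.cons true b : Fin (m + 1) → Bool) j) = Fin.cons false fun j => !b j := by
  funext j
  refine Fin.cases ?_ (fun i => ?_) j <;> simp

omit [Fintype ι] [DecidableEq ι] in
/-- Complement of a mask starting with `false`. [folklore] -/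
theorem not_cons_false {m : ℕ} (b : Fin m → Bool) :
    (fun j => !(Fin.cons false b : Fin (m + 1) → Bool) j) = Fin.cons true fun j => !b j := by
  funext j
  refine Fin.cases ?_ (fun i => ?_) j <;> simp

/-- **Leibniz formula** along a word: `∂^γ (f g) = ∑_{b} ∂^{γ,b} f · ∂^{γ,¬b} g`, the sum over
all masks `b` (sub-words of `γ` hit `f`, the complementary sub-word hits `g`). [folklore] -/
theorem ipderiv_mul {f g : 𝔼 → ℝ} (hf : ContDiff ℝ ∞ f) (hg : ContDiff ℝ ∞ g) :
    ∀ {m : ℕ} (γ : Fin m → ι), ipderiv γ (fun x => f x * g x) =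
      fun x => ∑ b : Fin m → Bool, ipderivSub γ b f x * ipderivSub γ (fun j => !b j) g x
  | 0, γ => by
      funext x
      simp
  | m + 1, γ => by
      have hdf : ∀ b : Fin m → Bool, Differentiable ℝ (ipderivSub (Fin.tail γ) b f) := fun b =>
        (contDiff_ipderivSub hf _ b).differentiable (by simp)
      have hdg : ∀ b : Fin m → Bool, Differentiable ℝ (ipderivSub (Fin.tail γ) b g) := fun b =>
        (contDiff_ipderivSub hg _ b).differentiable (by simp)
      rw [ipderiv_succ, ipderiv_mul hf hg (Fin.tail γ),
        pderiv_sum (f := fun b y => ipderivSub (Fin.tail γ) b f y *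
          ipderivSub (Fin.tail γ) (fun j => !b j) g y) _ (fun b _ => (hdf b).mul (hdg _))]
      funext x
      rw [sum_word_succ]
      simp only [Fintype.sum_bool, ipderivSub_cons_true, ipderivSub_cons_false, not_cons_true,
        not_cons_false, ← sum_add_distrib]
      refine sum_congr rfl fun b _ => ?_
      rw [pderiv_mul (hdf b) (hdg _)]

/-- **Leibniz remainder bound**: for a word `γ` of length `m`,
`|∂^γ (f g)(x) − f(x) ∂^γ g(x)| ≤ 2^m ∑_{a=1}^{m} |∇^a f (x)| |∇^{m-a} g (x)|`. [folklore] -/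
theorem abs_ipderiv_mul_sub_mul_ipderiv_le {f g : 𝔼 → ℝ} (hf : ContDiff ℝ ∞ f)
    (hg : ContDiff ℝ ∞ g) {m : ℕ} (γ : Fin m → ι) (x : 𝔼) :
    |ipderiv γ (fun y => f y * g y) x - f x * ipderiv γ g x| ≤
      2 ^ m * ∑ a ∈ Finset.Icc 1 m, dnorm a f x * dnorm (m - a) g x := by
  classical
  rw [ipderiv_mul hf hg γ]
  dsimp only
  set b0 : Fin m → Bool := fun _ => false with hb0
  have hsplit : ∑ b : Fin m → Bool, ipderivSub γ b f x * ipderivSub γ (fun j => !b j) g x =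
      f x * ipderiv γ g x +
        ∑ b ∈ univ.erase b0, ipderivSub γ b f x * ipderivSub γ (fun j => !b j) g x := by
    rw [← add_sum_erase _ _ (mem_univ b0)]
    congr 1
    rw [hb0, ipderivSub_false]
    simp only [Bool.not_false]
    rw [ipderivSub_true]
  rw [hsplit, add_sub_cancel_left]
  set S := ∑ a ∈ Finset.Icc 1 m, dnorm a f x * dnorm (m - a) g x with hS
  have hS0 : 0 ≤ S := sum_nonneg fun a _ => mul_nonneg (dnorm_nonneg _ _ _) (dnorm_nonneg _ _ _)
  have hterm : ∀ b ∈ univ.erase b0,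
      |ipderivSub γ b f x * ipderivSub γ (fun j => !b j) g x| ≤ S := by
    intro b hb
    have hb' : b ≠ b0 := ne_of_mem_erase hb
    rw [abs_mul]
    have h1 := abs_ipderivSub_le_dnorm γ b f x
    have h2 := abs_ipderivSub_le_dnorm γ (fun j => !b j) g x
    rw [maskCard_not] at h2
    have hmem : maskCard b ∈ Finset.Icc 1 m :=
      Finset.mem_Icc.2 ⟨maskCard_pos_of_ne hb', maskCard_le b⟩
    calc |ipderivSub γ b f x| * |ipderivSub γ (fun j => !b j) g x|
        ≤ dnorm (maskCard b) f x * dnorm (m - maskCard b) g x :=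
          mul_le_mul h1 h2 (abs_nonneg _) (dnorm_nonneg _ _ _)
      _ ≤ S := single_le_sum (f := fun a => dnorm a f x * dnorm (m - a) g x)
          (fun a _ => mul_nonneg (dnorm_nonneg _ _ _) (dnorm_nonneg _ _ _)) hmem
  calc |∑ b ∈ univ.erase b0, ipderivSub γ b f x * ipderivSub γ (fun j => !b j) g x|
      ≤ ∑ b ∈ univ.erase b0, |ipderivSub γ b f x * ipderivSub γ (fun j => !b j) g x| :=
        abs_sum_le_sum_abs _ _
    _ ≤ ∑ b ∈ univ.erase b0, S := sum_le_sum hterm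
    _ = ((univ.erase b0).card : ℝ) * S := by rw [sum_const, nsmul_eq_mul]
    _ ≤ 2 ^ m * S := by
        refine mul_le_mul_of_nonneg_right ?_ hS0
        have : ((univ.erase b0).card : ℝ) ≤ (Fintype.card (Fin m → Bool) : ℝ) := by
          exact_mod_cast (card_le_univ _)
        refine this.trans ?_
        simp

/-! ### Comparison with the Fréchet tensor `iteratedFDeriv` -/

/-- `∂^α f (x) = D^m f (x) (e_{α 0}, …, e_{α (m-1)})`. [folklore] -/
theorem ipderiv_eq_iteratedFDeriv {f : 𝔼 → ℝ} (hf : ContDiff ℝ ∞ f) :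
    ∀ {m : ℕ} (α : Fin m → ι) (x : 𝔼),
      ipderiv α f x = iteratedFDeriv ℝ m f x (fun j => stdVec (α j))
  | 0, α, x => by simp
  | m + 1, α, x => by
      have hd : DifferentiableAt ℝ (iteratedFDeriv ℝ m f) x :=
        (hf.differentiable_iteratedFDeriv (by exact_mod_cast ENat.coe_lt_top m)) x
      rw [hd.iteratedFDeriv_succ_apply_left', ipderiv_succ, pderiv_apply]
      have hfun : ipderiv (Fin.tail α) f =
          fun y => iteratedFDeriv ℝ m f y (Fin.tail fun j => (stdVec (α j) : 𝔼)) :=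
        funext fun y => ipderiv_eq_iteratedFDeriv hf (Fin.tail α) y
      rw [hfun]

/-- `|∂^α f (x)| ≤ ‖D^m f (x)‖` (each `e_l` is a unit vector). [folklore] -/
theorem abs_ipderiv_le_norm_iteratedFDeriv {f : 𝔼 → ℝ} (hf : ContDiff ℝ ∞ f) {m : ℕ}
    (α : Fin m → ι) (x : 𝔼) : |ipderiv α f x| ≤ ‖iteratedFDeriv ℝ m f x‖ := by
  rw [ipderiv_eq_iteratedFDeriv hf, ← Real.norm_eq_abs]
  refine (ContinuousMultilinearMap.le_opNorm _ _).trans ?_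
  have : ∏ j, ‖(stdVec (α j) : 𝔼)‖ = 1 := by simp [stdVec]
  rw [this, mul_one]

/-- `|∇^m f (x)|² ≤ (card ι)^m ‖D^m f (x)‖²`. [folklore] -/
theorem dnormSq_le_card_pow_mul_sq_norm_iteratedFDeriv {f : 𝔼 → ℝ} (hf : ContDiff ℝ ∞ f)
    (m : ℕ) (x : 𝔼) :
    dnormSq m f x ≤ (Fintype.card ι : ℝ) ^ m * ‖iteratedFDeriv ℝ m f x‖ ^ 2 := by
  unfold dnormSq
  calc ∑ α : Fin m → ι, ipderiv α f x ^ 2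
      ≤ ∑ _α : Fin m → ι, ‖iteratedFDeriv ℝ m f x‖ ^ 2 := sum_le_sum fun α _ => by
        rw [← sq_abs]
        exact pow_le_pow_left₀ (abs_nonneg _) (abs_ipderiv_le_norm_iteratedFDeriv hf α x) 2
    _ = (Fintype.card ι : ℝ) ^ m * ‖iteratedFDeriv ℝ m f x‖ ^ 2 := by
        rw [sum_const, card_univ, Fintype.card_fun, Fintype.card_fin, nsmul_eq_mul]
        push_cast
        ring

/-- Expansion of a multilinear form on `ℝ^ι` in the standard basis:
`A(v) = ∑_α (∏_j v_j(α_j)) A(e_{α 0}, …, e_{α (m-1)})`. [folklore] -/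
theorem multilinear_apply_eq_sum_word {m : ℕ} (A : 𝔼 [×m]→L[ℝ] ℝ) (v : Fin m → 𝔼) :
    A v = ∑ α : Fin m → ι, (∏ j, v j (α j)) * A (fun j => stdVec (α j)) := by
  have hv : v = fun j => ∑ l, v j l • (stdVec l : 𝔼) := by
    funext j
    conv_lhs => rw [← (EuclideanSpace.basisFun ι ℝ).sum_repr (v j)]
    simp [stdVec, EuclideanSpace.basisFun_apply]
  conv_lhs => rw [hv]
  rw [A.map_sum]
  refine sum_congr rfl fun α _ => ?_
  rw [A.map_smul_univ, smul_eq_mul]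

/-- **Operator norm versus coordinates**: `‖A‖ ≤ ∑_α |A(e_α)|` for a multilinear form on
`ℝ^ι`. [folklore] -/
theorem multilinear_norm_le_sum_abs_apply_word {m : ℕ} (A : 𝔼 [×m]→L[ℝ] ℝ) :
    ‖A‖ ≤ ∑ α : Fin m → ι, |A (fun j => stdVec (α j))| := by
  refine A.opNorm_le_bound (sum_nonneg fun _ _ => abs_nonneg _) fun v => ?_
  rw [multilinear_apply_eq_sum_word, Real.norm_eq_abs]
  refine (abs_sum_le_sum_abs _ _).trans ?_
  rw [sum_mul]
  refine sum_le_sum fun α _ => ?_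
  rw [abs_mul, mul_comm]
  refine mul_le_mul_of_nonneg_left ?_ (abs_nonneg _)
  rw [abs_prod]
  exact prod_le_prod (fun j _ => abs_nonneg _) fun j _ => by
    rw [← Real.norm_eq_abs]
    exact PiLp.norm_apply_le (v j) (α j)

/-- `‖D^m f (x)‖ ≤ ∑_α |∂^α f (x)|`. [folklore] -/
theorem norm_iteratedFDeriv_le_sum_abs_ipderiv {f : 𝔼 → ℝ} (hf : ContDiff ℝ ∞ f) (m : ℕ)
    (x : 𝔼) : ‖iteratedFDeriv ℝ m f x‖ ≤ ∑ α : Fin m → ι, |ipderiv α f x| := by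
  refine (multilinear_norm_le_sum_abs_apply_word _).trans (le_of_eq ?_)
  exact sum_congr rfl fun α _ => by rw [ipderiv_eq_iteratedFDeriv hf]

/-- `‖D^m f (x)‖² ≤ (card ι)^m |∇^m f (x)|²`. [folklore] -/
theorem sq_norm_iteratedFDeriv_le_card_pow_mul_dnormSq {f : 𝔼 → ℝ} (hf : ContDiff ℝ ∞ f)
    (m : ℕ) (x : 𝔼) :
    ‖iteratedFDeriv ℝ m f x‖ ^ 2 ≤ (Fintype.card ι : ℝ) ^ m * dnormSq m f x := by
  calc ‖iteratedFDeriv ℝ m f x‖ ^ 2 ≤ (∑ α : Fin m → ι, |ipderiv α f x|) ^ 2 :=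
        pow_le_pow_left₀ (norm_nonneg _) (norm_iteratedFDeriv_le_sum_abs_ipderiv hf m x) 2
    _ ≤ (univ : Finset (Fin m → ι)).card * ∑ α : Fin m → ι, |ipderiv α f x| ^ 2 :=
        sq_sum_le_card_mul_sum_sq
    _ = (Fintype.card ι : ℝ) ^ m * dnormSq m f x := by
        rw [card_univ, Fintype.card_fun, Fintype.card_fin, dnormSq]
        push_cast
        simp [sq_abs]

/-! ### Components of Euclidean-space-valued maps -/

section Components

variable {κ : Type*} [Fintype κ]

omit [Fintype ι] [DecidableEq ι] in
/-- The coordinate projections of `ℝ^κ` have operator norm at most one. [folklore] -/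
theorem norm_euclidean_proj_le_one (c : κ) : ‖(EuclideanSpace.proj c : EuclideanSpace ℝ κ →L[ℝ] ℝ)‖ ≤ 1 := by
  refine ContinuousLinearMap.opNorm_le_bound _ zero_le_one fun v => ?_
  rw [one_mul]
  exact PiLp.norm_apply_le v c

omit [DecidableEq ι] in
/-- Components have smaller derivatives: `‖D^m u_c (x)‖ ≤ ‖D^m u (x)‖`. [folklore] -/
theorem norm_iteratedFDeriv_apply_le {u : 𝔼 → EuclideanSpace ℝ κ} (hu : ContDiff ℝ ∞ u)
    (c : κ) (m : ℕ) (x : 𝔼) :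
    ‖iteratedFDeriv ℝ m (fun y => u y c) x‖ ≤ ‖iteratedFDeriv ℝ m u x‖ := by
  have h := (EuclideanSpace.proj c : EuclideanSpace ℝ κ →L[ℝ] ℝ).norm_iteratedFDeriv_comp_left
    (hu.contDiffAt (x := x)) (n := m) (by exact_mod_cast le_top)
  have hcomp : ((EuclideanSpace.proj c : EuclideanSpace ℝ κ →L[ℝ] ℝ) ∘ u) = fun y => u y c := rfl
  rw [hcomp] at h
  exact h.trans ((mul_le_mul_of_nonneg_right (norm_euclidean_proj_le_one c) (norm_nonneg _)).trans
    (by rw [one_mul]))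

omit [DecidableEq ι] in
/-- The derivative of a map into `ℝ^κ` is controlled by those of its components:
`‖D^m u (x)‖ ≤ ∑_c ‖D^m u_c (x)‖`. [folklore] -/
theorem norm_iteratedFDeriv_le_sum_norm_iteratedFDeriv_apply [DecidableEq κ]
    {u : 𝔼 → EuclideanSpace ℝ κ} (hu : ContDiff ℝ ∞ u) (m : ℕ) (x : 𝔼) :
    ‖iteratedFDeriv ℝ m u x‖ ≤ ∑ c, ‖iteratedFDeriv ℝ m (fun y => u y c) x‖ := by
  have hc : ∀ c, ContDiff ℝ ∞ fun y => u y c := fun c => contDiff_euclidean.1 hu c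
  have hu_eq : u = fun y => ∑ c, (u y c) • (EuclideanSpace.single c (1 : ℝ) : EuclideanSpace ℝ κ) := by
    funext y
    conv_lhs => rw [← (EuclideanSpace.basisFun κ ℝ).sum_repr (u y)]
    simp [EuclideanSpace.basisFun_apply]
  have h1 : iteratedFDeriv ℝ m u x =
      ∑ c, iteratedFDeriv ℝ m (fun y => (u y c) • (EuclideanSpace.single c (1 : ℝ) :
        EuclideanSpace ℝ κ)) x := by
    conv_lhs => rw [hu_eq]
    exact iteratedFDeriv_fun_sum_apply fun c _ => ((hc c).smul contDiff_const).contDiffAt.of_le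
      (by exact_mod_cast le_top)
  rw [h1]
  refine (norm_sum_le _ _).trans (sum_le_sum fun c _ => ?_)
  rw [iteratedFDeriv_smul_const_apply ((hc c).contDiffAt.of_le (by exact_mod_cast le_top))]
  refine (ContinuousLinearMap.norm_compContinuousMultilinearMap_le _ _).trans ?_
  have : ‖((ContinuousLinearMap.id ℝ ℝ).smulRight
      (EuclideanSpace.single c (1 : ℝ) : EuclideanSpace ℝ κ))‖ ≤ 1 := by
    refine ContinuousLinearMap.opNorm_le_bound _ zero_le_one fun r => ?_
    simp [norm_smul]
  exact (mul_le_mul_of_nonneg_right this (norm_nonneg _)).trans (by rw [one_mul])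

end Components

/-! ### Finite families of scalar functions as Euclidean-space-valued maps -/

section Families

variable {κ : Type*} [Fintype κ]

/-- The family `(g_c)_{c ∈ κ}` of scalar functions bundled into one map `𝔼 → ℝ^κ`
(so that `‖famVec g x‖² = ∑_c g_c(x)²`). [folklore] -/
def famVec (g : κ → 𝔼 → ℝ) (x : 𝔼) : EuclideanSpace ℝ κ := WithLp.toLp 2 fun c => g c x

omit [Fintype ι] [DecidableEq ι] [Fintype κ] in
/-- Components of `famVec`. [folklore] -/
@[simp]
theorem famVec_apply (g : κ → 𝔼 → ℝ) (x : 𝔼) (c : κ) : famVec g x c = g c x := rfl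

omit [Fintype ι] [DecidableEq ι] in
/-- `‖famVec g x‖² = ∑_c g_c(x)²`. [folklore] -/
theorem sq_norm_famVec (g : κ → 𝔼 → ℝ) (x : 𝔼) : ‖famVec g x‖ ^ 2 = ∑ c, g c x ^ 2 := by
  rw [EuclideanSpace.norm_eq, Real.sq_sqrt (sum_nonneg fun _ _ => sq_nonneg _)]
  simp [sq_abs]

omit [Fintype ι] [DecidableEq ι] in
/-- `‖famVec g x‖ = (∑_c g_c(x)²)^{1/2}`. [folklore] -/
theorem norm_famVec (g : κ → 𝔼 → ℝ) (x : 𝔼) : ‖famVec g x‖ = Real.sqrt (∑ c, g c x ^ 2) := by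
  rw [← sq_norm_famVec, Real.sqrt_sq (norm_nonneg _)]

omit [DecidableEq ι] in
/-- A bundled family of `Cⁿ` functions is `Cⁿ`. [folklore] -/
theorem contDiff_famVec {n : WithTop ℕ∞} {g : κ → 𝔼 → ℝ} (hg : ∀ c, ContDiff ℝ n (g c)) :
    ContDiff ℝ n (famVec g) :=
  contDiff_euclidean.2 fun c => hg c

omit [DecidableEq ι] in
/-- A bundled family of continuous functions is continuous. [folklore] -/
theorem continuous_famVec {g : κ → 𝔼 → ℝ} (hg : ∀ c, Continuous (g c)) :
    Continuous (famVec g) :=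
  (contDiff_famVec (n := 0) fun c => contDiff_zero.2 (hg c)).continuous

omit [DecidableEq ι] in
/-- Components of the derivative of a bundled family. [folklore] -/
theorem fderiv_famVec_apply {g : κ → 𝔼 → ℝ} (hg : ∀ c, Differentiable ℝ (g c)) (x v : 𝔼)
    (c : κ) : fderiv ℝ (famVec g) x v c = fderiv ℝ (g c) x v := by
  have hF : DifferentiableAt ℝ (famVec g) x := (differentiable_euclidean.2 hg) x
  have h1 : HasFDerivAt (fun y => famVec g y c)
      ((EuclideanSpace.proj c : EuclideanSpace ℝ κ →L[ℝ] ℝ).comp (fderiv ℝ (famVec g) x)) x :=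
    (EuclideanSpace.proj c : EuclideanSpace ℝ κ →L[ℝ] ℝ).hasFDerivAt.comp x hF.hasFDerivAt
  have h2 : (fun y => famVec g y c) = g c := rfl
  rw [h2] at h1
  rw [h1.fderiv]
  rfl

/-- `D(famVec g)(x) e_l = famVec (∂_l g)(x)`. [folklore] -/
theorem fderiv_famVec_stdVec {g : κ → 𝔼 → ℝ} (hg : ∀ c, Differentiable ℝ (g c)) (x : 𝔼)
    (l : ι) : fderiv ℝ (famVec g) x (stdVec l) = famVec (fun c => pderiv l (g c)) x := by
  ext c
  rw [fderiv_famVec_apply hg]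
  rfl

omit [DecidableEq ι] in
/-- **Operator norm versus Frobenius norm** on `ℝ^ι`: `‖L‖² ≤ ∑_l ‖L e_l‖²`. [folklore] -/
theorem sq_opNorm_le_sum_sq_norm_apply_stdVec [DecidableEq ι] {F : Type*} [NormedAddCommGroup F]
    [NormedSpace ℝ F] (L : 𝔼 →L[ℝ] F) : ‖L‖ ^ 2 ≤ ∑ l, ‖L (stdVec l)‖ ^ 2 := by
  set S := ∑ l, ‖L (stdVec l)‖ ^ 2 with hS
  have hS0 : 0 ≤ S := sum_nonneg fun _ _ => sq_nonneg _
  have hle : ‖L‖ ≤ Real.sqrt S := by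
    refine ContinuousLinearMap.opNorm_le_bound _ (Real.sqrt_nonneg _) fun x => ?_
    have hx : L x = ∑ l, x l • L (stdVec l) := by
      conv_lhs => rw [← (EuclideanSpace.basisFun ι ℝ).sum_repr x]
      simp [map_sum, map_smul, stdVec, EuclideanSpace.basisFun_apply]
    have h1 : ‖L x‖ ≤ ∑ l, |x l| * ‖L (stdVec l)‖ := by
      rw [hx]
      refine (norm_sum_le _ _).trans (le_of_eq (sum_congr rfl fun l _ => ?_))
      rw [norm_smul, Real.norm_eq_abs]
    have h2 : (∑ l, |x l| * ‖L (stdVec l)‖) ^ 2 ≤ (∑ l, |x l| ^ 2) * S :=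
      sum_mul_sq_le_sq_mul_sq _ _ _
    have h3 : ∑ l, |x l| ^ 2 = ‖x‖ ^ 2 := by
      rw [EuclideanSpace.norm_eq, Real.sq_sqrt (sum_nonneg fun _ _ => sq_nonneg _)]
      simp
    rw [h3] at h2
    have h0 : 0 ≤ ∑ l, |x l| * ‖L (stdVec l)‖ :=
      sum_nonneg fun l _ => mul_nonneg (abs_nonneg _) (norm_nonneg _)
    have h4 : ∑ l, |x l| * ‖L (stdVec l)‖ ≤ Real.sqrt S * ‖x‖ := by
      rw [← Real.sqrt_sq h0, ← Real.sqrt_sq (norm_nonneg x), ← Real.sqrt_mul hS0]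
      exact Real.sqrt_le_sqrt (by nlinarith [h2])
    exact h1.trans h4
  calc ‖L‖ ^ 2 ≤ (Real.sqrt S) ^ 2 := pow_le_pow_left₀ (norm_nonneg _) hle 2
    _ = S := Real.sq_sqrt hS0

/-- The derivative of a bundled family is controlled by the bundled partial derivatives:
`‖D(famVec g)(x)‖² ≤ ∑_l ∑_c (∂_l g_c (x))²`. [folklore] -/
theorem sq_norm_fderiv_famVec_le {g : κ → 𝔼 → ℝ} (hg : ∀ c, Differentiable ℝ (g c)) (x : 𝔼) :
    ‖fderiv ℝ (famVec g) x‖ ^ 2 ≤ ∑ l, ∑ c, pderiv l (g c) x ^ 2 := by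
  refine (sq_opNorm_le_sum_sq_norm_apply_stdVec _).trans (le_of_eq (sum_congr rfl fun l _ => ?_))
  rw [fderiv_famVec_stdVec hg, sq_norm_famVec]

end Families

/-! ## The coordinate tensors `|Dᵐ v|²`, `|Dᵐ Ω|²` of a vector field and its vorticity -/

section Levels

/-- `levelSq m v x = |∇ᵐ v (x)|² = ∑ᵢ ∑_{|β| = m} (∂^β vᵢ (x))²`, the squared Euclidean norm of
the `m`-th coordinate derivative tensor of a vector field (Doering–Gibbon's `|Dᵐv|²`, (6.1.2)).
Orders `0` and `1` are existing tree notions: `levelSq 0 v x = ‖v x‖²`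
(`levelSq_zero_eq_norm_sq`) and `levelSq 1 v x = frobeniusNormSq (fderiv ℝ v x)`, the
Frobenius norm of `VectorCalculus` (`levelSq_one_eq_frobeniusNormSq`, `v` differentiable at
`x`). [folklore] -/
def levelSq (m : ℕ) (v : 𝔼 → 𝔼) (x : 𝔼) : ℝ :=
  ∑ i, dnormSq m (fun y => v y i) x

/-- The vorticity components `Ω_{ki} = ∂ₖ vᵢ − ∂ᵢ vₖ`: the matrix entries of the tree's spin
matrix `Fluid.spin v x = Dv(x) − Dv(x)ᵀ` of `VectorCalculus`, `vortComp v k i x = spin v x eₖ i`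
(`vortComp_eq_spin_apply`, `v` differentiable at `x`); in dimension three
`∑_{k,i} Ω_{ki}² = 2 ‖curl v‖²` (`VectorCalculus.norm_curl_sq_eq_frobeniusNormSq_spin`). The
scalar component form is kept because the energy method differentiates each `Ω_{ki}` along
words (`vortFam`). [folklore] -/
def vortComp (v : 𝔼 → 𝔼) (k i : ι) : 𝔼 → ℝ :=
  fun y => pderiv k (fun z => v z i) y - pderiv i (fun z => v z k) y

/-- `vortSq m v x = |∇ᵐ Ω (x)|² = ∑_{k,i} ∑_{|β| = m} (∂^β Ω_{ki} (x))²`; order `0` is the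
Frobenius norm of the spin matrix, `vortSq 0 v x = frobeniusNormSq (spin v x)`
(`vortSq_zero_eq_frobeniusNormSq_spin`; `= 2 ‖curl v x‖²` on `ℝ³`). [folklore] -/
def vortSq (m : ℕ) (v : 𝔼 → 𝔼) (x : 𝔼) : ℝ :=
  ∑ k, ∑ i, dnormSq m (vortComp v k i) x

/-- `0 ≤ |∇ᵐ v|²`. [folklore] -/
theorem levelSq_nonneg (m : ℕ) (v : 𝔼 → 𝔼) (x : 𝔼) : 0 ≤ levelSq m v x :=
  Finset.sum_nonneg fun _ _ => dnormSq_nonneg _ _ _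

/-- `0 ≤ |∇ᵐ Ω|²`. [folklore] -/
theorem vortSq_nonneg (m : ℕ) (v : 𝔼 → 𝔼) (x : 𝔼) : 0 ≤ vortSq m v x :=
  Finset.sum_nonneg fun _ _ => Finset.sum_nonneg fun _ _ => dnormSq_nonneg _ _ _

variable {v : EuclideanSpace ℝ ι → EuclideanSpace ℝ ι}

omit [DecidableEq ι] in
/-- Components of a smooth vector field are smooth. [folklore] -/
theorem contDiff_comp_of_contDiff (hv : ContDiff ℝ ∞ v) (i : ι) : ContDiff ℝ ∞ fun y => v y i :=
  contDiff_euclidean.1 hv i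

/-- The vorticity components of a smooth field are smooth. [folklore] -/
theorem contDiff_vortComp (hv : ContDiff ℝ ∞ v) (k i : ι) : ContDiff ℝ ∞ (vortComp v k i) :=
  (contDiff_pderiv (contDiff_comp_of_contDiff hv i) k).sub
    (contDiff_pderiv (contDiff_comp_of_contDiff hv k) i)

/-- `|∇ᵐ v|²` is continuous for smooth `v`. [folklore] -/
theorem continuous_levelSq (hv : ContDiff ℝ ∞ v) (m : ℕ) : Continuous (levelSq m v) := by
  unfold levelSq
  exact continuous_finsetSum _ fun i _ => continuous_dnormSq (contDiff_comp_of_contDiff hv i) m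

/-- `|∇ᵐ Ω|²` is continuous for smooth `v`. [folklore] -/
theorem continuous_vortSq (hv : ContDiff ℝ ∞ v) (m : ℕ) : Continuous (vortSq m v) := by
  unfold vortSq
  exact continuous_finsetSum _ fun k _ => continuous_finsetSum _ fun i _ =>
    continuous_dnormSq (contDiff_vortComp hv k i) m

/-- `|∇ᵐ v|²` is smooth for smooth `v`. [folklore] -/
theorem contDiff_levelSq (hv : ContDiff ℝ ∞ v) (m : ℕ) : ContDiff ℝ ∞ (levelSq m v) := by
  unfold levelSq
  exact ContDiff.sum fun i _ => contDiff_dnormSq (contDiff_comp_of_contDiff hv i) m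

/-- `|∇ᵐ Ω|²` is smooth for smooth `v`. [folklore] -/
theorem contDiff_vortSq (hv : ContDiff ℝ ∞ v) (m : ℕ) : ContDiff ℝ ∞ (vortSq m v) := by
  unfold vortSq
  exact ContDiff.sum fun k _ => ContDiff.sum fun i _ => contDiff_dnormSq (contDiff_vortComp hv k i) m

/-- Word derivatives of the vorticity components:
`∂^β Ω_{ki} = ∂ₖ ∂^β vᵢ − ∂ᵢ ∂^β vₖ`. [folklore] -/
theorem ipderiv_vortComp (hv : ContDiff ℝ ∞ v) (k i : ι) {m : ℕ} (β : Fin m → ι) (x : 𝔼) :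
    ipderiv β (vortComp v k i) x =
      pderiv k (ipderiv β fun y => v y i) x - pderiv i (ipderiv β fun y => v y k) x := by
  unfold vortComp
  rw [ipderiv_sub (contDiff_pderiv (contDiff_comp_of_contDiff hv i) k)
    (contDiff_pderiv (contDiff_comp_of_contDiff hv k) i)]
  simp only
  rw [ipderiv_pderiv (contDiff_comp_of_contDiff hv i), ipderiv_pderiv (contDiff_comp_of_contDiff hv k)]

/-- `|∇^{m+1} v|² = ∑_β ∑ₖ ∑ᵢ (∂ₖ ∂^β vᵢ)²` (splitting off the outermost derivative). [folklore] -/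
theorem levelSq_succ_eq (v : 𝔼 → 𝔼) (m : ℕ) (x : 𝔼) :
    levelSq (m + 1) v x = ∑ β : Fin m → ι, ∑ k, ∑ i, pderiv k (ipderiv β fun y => v y i) x ^ 2 := by
  unfold levelSq
  simp_rw [dnormSq_succ_eq_sum_cons]
  calc ∑ i, ∑ k, ∑ β : Fin m → ι, pderiv k (ipderiv β fun y => v y i) x ^ 2
      = ∑ i, ∑ β : Fin m → ι, ∑ k, pderiv k (ipderiv β fun y => v y i) x ^ 2 :=
        Finset.sum_congr rfl fun i _ => Finset.sum_comm
    _ = ∑ β : Fin m → ι, ∑ i, ∑ k, pderiv k (ipderiv β fun y => v y i) x ^ 2 := Finset.sum_comm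
    _ = ∑ β : Fin m → ι, ∑ k, ∑ i, pderiv k (ipderiv β fun y => v y i) x ^ 2 :=
        Finset.sum_congr rfl fun β _ => Finset.sum_comm

/-- `|∇ᵐ Ω|² = ∑_β ∑ₖ ∑ᵢ (∂ₖ ∂^β vᵢ − ∂ᵢ ∂^β vₖ)²`. [folklore] -/
theorem vortSq_eq (hv : ContDiff ℝ ∞ v) (m : ℕ) (x : 𝔼) :
    vortSq m v x = ∑ β : Fin m → ι, ∑ k, ∑ i,
      (pderiv k (ipderiv β fun y => v y i) x - pderiv i (ipderiv β fun y => v y k) x) ^ 2 := by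
  unfold vortSq dnormSq
  simp_rw [ipderiv_vortComp hv]
  calc ∑ k, ∑ i, ∑ β : Fin m → ι,
        (pderiv k (ipderiv β fun y => v y i) x - pderiv i (ipderiv β fun y => v y k) x) ^ 2
      = ∑ k, ∑ β : Fin m → ι, ∑ i,
          (pderiv k (ipderiv β fun y => v y i) x - pderiv i (ipderiv β fun y => v y k) x) ^ 2 :=
        Finset.sum_congr rfl fun k _ => Finset.sum_comm
    _ = _ := Finset.sum_comm

omit [DecidableEq ι] in
/-- **Antisymmetrisation is bounded**: for any real matrix `a`,
`∑_{k,i} (a_{ki} − a_{ik})² ≤ 4 ∑_{k,i} a_{ki}²`. [folklore] -/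
theorem sum_sq_sub_transpose_le (a : ι → ι → ℝ) :
    ∑ k, ∑ i, (a k i - a i k) ^ 2 ≤ 4 * ∑ k, ∑ i, a k i ^ 2 := by
  have h1 : ∀ k i, (a k i - a i k) ^ 2 ≤ 2 * a k i ^ 2 + 2 * a i k ^ 2 := fun k i => by
    nlinarith [sq_nonneg (a k i + a i k)]
  calc ∑ k, ∑ i, (a k i - a i k) ^ 2 ≤ ∑ k, ∑ i, (2 * a k i ^ 2 + 2 * a i k ^ 2) :=
        Finset.sum_le_sum fun k _ => Finset.sum_le_sum fun i _ => h1 k i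
    _ = 2 * ∑ k, ∑ i, a k i ^ 2 + 2 * ∑ k, ∑ i, a i k ^ 2 := by
        simp only [Finset.sum_add_distrib, Finset.mul_sum]
    _ = 4 * ∑ k, ∑ i, a k i ^ 2 := by
        rw [Finset.sum_comm (f := fun k i => a i k ^ 2)]
        ring

omit [DecidableEq ι] in
/-- **The div–curl algebra**: for any real matrix `a`,
`∑_{k,i} a_{ki}² = ½ ∑_{k,i} (a_{ki} − a_{ik})² + ∑_{k,i} a_{ki} a_{ik}`. [folklore] -/
theorem sum_sq_eq_half_sum_sq_sub_add (a : ι → ι → ℝ) :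
    ∑ k, ∑ i, a k i ^ 2 = 2⁻¹ * ∑ k, ∑ i, (a k i - a i k) ^ 2 + ∑ k, ∑ i, a k i * a i k := by
  have hexp : ∑ k, ∑ i, (a k i - a i k) ^ 2 =
      ∑ k, ∑ i, a k i ^ 2 + ∑ k, ∑ i, a i k ^ 2 - 2 * ∑ k, ∑ i, a k i * a i k := by
    have : ∀ k i, (a k i - a i k) ^ 2 = a k i ^ 2 + a i k ^ 2 - 2 * (a k i * a i k) := fun k i => by
      ring
    simp only [this, Finset.sum_sub_distrib, Finset.sum_add_distrib, Finset.mul_sum]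
  rw [hexp, Finset.sum_comm (f := fun k i => a i k ^ 2)]
  ring

/-- **`|∇ᵐ Ω|² ≤ 4 |∇^{m+1} v|²`** pointwise. [folklore] -/
theorem vortSq_le_four_mul_levelSq_succ (hv : ContDiff ℝ ∞ v) (m : ℕ) (x : 𝔼) :
    vortSq m v x ≤ 4 * levelSq (m + 1) v x := by
  rw [vortSq_eq hv, levelSq_succ_eq, Finset.mul_sum]
  exact Finset.sum_le_sum fun β _ =>
    sum_sq_sub_transpose_le (fun k i => pderiv k (ipderiv β fun y => v y i) x)

/-- **Derivatives of divergence-free fields are divergence free**: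
`∑ᵢ ∂ᵢ ∂^β vᵢ = ∂^β (∑ᵢ ∂ᵢ vᵢ) = 0`. The divergence-free hypothesis is taken in the coordinate
form `hdiv : ∀ x, ∑ᵢ ∂ᵢ vᵢ (x) = 0`, which for a differentiable field is equivalent to the tree's
`Fluid.IsDivFree v` (`IsDivFree.sum_pderiv_comp_eq_zero` / `isDivFree_of_sum_pderiv_comp_eq_zero`
in section `Bridges`, via `divergence_eq_sum_pderiv`); consumers holding an
`IsClassicalNSSolutionOn` obtain `hdiv` from its `divergence_free` field this way. [folklore] -/
theorem sum_pderiv_ipderiv_eq_zero (hv : ContDiff ℝ ∞ v)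
    (hdiv : ∀ x, ∑ i, pderiv i (fun y => v y i) x = 0) {m : ℕ} (β : Fin m → ι) (x : 𝔼) :
    ∑ i, pderiv i (ipderiv β fun y => v y i) x = 0 := by
  have h1 : ∀ i, pderiv i (ipderiv β fun y => v y i) x = ipderiv β (pderiv i fun y => v y i) x :=
    fun i => by rw [pderiv_ipderiv (contDiff_comp_of_contDiff hv i)]
  simp only [h1]
  have h2 := congrFun (ipderiv_finset_sum Finset.univ
    (f := fun i y => pderiv i (fun z => v z i) y)
    (fun i => contDiff_pderiv (contDiff_comp_of_contDiff hv i) i) β) x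
  simp only at h2
  rw [← h2]
  have h3 : (fun y => ∑ i, pderiv i (fun z => v z i) y) = fun _ => (0 : ℝ) := funext hdiv
  rw [h3, ipderiv_zero_fun]

/-! ### The bundled families `(∂^γ vᵢ)_{(γ,i)}` and `(∂^β Ω_{ki})_{(β,k,i)}` -/

/-- The family of all `m`-th coordinate derivatives of all components of a vector field, indexed
by pairs `(γ, i)` (word, component): `levelFam m v (γ, i) = ∂^γ vᵢ`; bundled by `famVec` it is a
map into `ℝ^{ιᵐ × ι}` of pointwise squared norm `levelSq m v`. [folklore] -/
def levelFam (m : ℕ) (v : 𝔼 → 𝔼) : (Fin m → ι) × ι → 𝔼 → ℝ :=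
  fun c => ipderiv c.1 fun y => v y c.2

/-- The family of all `m`-th coordinate derivatives of all vorticity components, indexed by
triples `(β, k, i)`: `vortFam m v (β, k, i) = ∂^β Ω_{ki}`; bundled by `famVec` it has pointwise
squared norm `vortSq m v`. [folklore] -/
def vortFam (m : ℕ) (v : 𝔼 → 𝔼) : (Fin m → ι) × ι × ι → 𝔼 → ℝ :=
  fun c => ipderiv c.1 (vortComp v c.2.1 c.2.2)

omit [Fintype ι] in
/-- Unfolding `levelFam`. [folklore] -/
@[simp]
theorem levelFam_apply (m : ℕ) (v : 𝔼 → 𝔼) (c : (Fin m → ι) × ι) :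
    levelFam m v c = ipderiv c.1 fun y => v y c.2 := rfl

omit [Fintype ι] in
/-- Unfolding `vortFam`. [folklore] -/
@[simp]
theorem vortFam_apply (m : ℕ) (v : 𝔼 → 𝔼) (c : (Fin m → ι) × ι × ι) :
    vortFam m v c = ipderiv c.1 (vortComp v c.2.1 c.2.2) := rfl

/-- Members of `levelFam` are smooth. [folklore] -/
theorem contDiff_levelFam (hv : ContDiff ℝ ∞ v) (m : ℕ) (c : (Fin m → ι) × ι) :
    ContDiff ℝ ∞ (levelFam m v c) :=
  contDiff_ipderiv (contDiff_comp_of_contDiff hv c.2) c.1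

/-- Members of `vortFam` are smooth. [folklore] -/
theorem contDiff_vortFam (hv : ContDiff ℝ ∞ v) (m : ℕ) (c : (Fin m → ι) × ι × ι) :
    ContDiff ℝ ∞ (vortFam m v c) :=
  contDiff_ipderiv (contDiff_vortComp hv c.2.1 c.2.2) c.1

/-- `∑_{(γ,i)} (∂^γ vᵢ)² = |∇ᵐ v|²`. [folklore] -/
theorem sum_sq_levelFam (m : ℕ) (v : 𝔼 → 𝔼) (x : 𝔼) :
    ∑ c, levelFam m v c x ^ 2 = levelSq m v x := by
  rw [Fintype.sum_prod_type, levelSq]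
  simp only [levelFam_apply, dnormSq]
  exact sum_comm

/-- `∑ₗ ∑_{(γ,i)} (∂ₗ ∂^γ vᵢ)² = |∇^{m+1} v|²`. [folklore] -/
theorem sum_sq_pderiv_levelFam (m : ℕ) (v : 𝔼 → 𝔼) (x : 𝔼) :
    ∑ l, ∑ c, pderiv l (levelFam m v c) x ^ 2 = levelSq (m + 1) v x := by
  rw [levelSq_succ_eq]
  simp only [levelFam_apply, Fintype.sum_prod_type]
  exact sum_comm

/-- `∑_{(β,k,i)} (∂^β Ω_{ki})² = |∇ᵐ Ω|²`. [folklore] -/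
theorem sum_sq_vortFam (m : ℕ) (v : 𝔼 → 𝔼) (x : 𝔼) :
    ∑ c, vortFam m v c x ^ 2 = vortSq m v x := by
  rw [Fintype.sum_prod_type, vortSq]
  simp only [vortFam_apply, dnormSq, Fintype.sum_prod_type]
  rw [sum_comm]
  exact sum_congr rfl fun k _ => sum_comm

/-- `∑ₗ ∑_{(β,k,i)} (∂ₗ ∂^β Ω_{ki})² = |∇^{m+1} Ω|²`. [folklore] -/
theorem sum_sq_pderiv_vortFam (m : ℕ) (v : 𝔼 → 𝔼) (x : 𝔼) :
    ∑ l, ∑ c, pderiv l (vortFam m v c) x ^ 2 = vortSq (m + 1) v x := by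
  simp only [vortSq, dnormSq_succ_eq_sum_cons, vortFam_apply, Fintype.sum_prod_type]
  -- LHS `∑ l, ∑ β, ∑ k, ∑ i`, RHS `∑ k, ∑ i, ∑ l, ∑ β`
  calc ∑ l, ∑ β : Fin m → ι, ∑ k, ∑ i, pderiv l (ipderiv β (vortComp v k i)) x ^ 2
      = ∑ l, ∑ k, ∑ β : Fin m → ι, ∑ i, pderiv l (ipderiv β (vortComp v k i)) x ^ 2 :=
        sum_congr rfl fun l _ => sum_comm
    _ = ∑ k, ∑ l, ∑ β : Fin m → ι, ∑ i, pderiv l (ipderiv β (vortComp v k i)) x ^ 2 := sum_comm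
    _ = ∑ k, ∑ l, ∑ i, ∑ β : Fin m → ι, pderiv l (ipderiv β (vortComp v k i)) x ^ 2 :=
        sum_congr rfl fun k _ => sum_congr rfl fun l _ => sum_comm
    _ = ∑ k, ∑ i, ∑ l, ∑ β : Fin m → ι, pderiv l (ipderiv β (vortComp v k i)) x ^ 2 :=
        sum_congr rfl fun k _ => sum_comm

/-- `‖famVec (levelFam m v) x‖² = |∇ᵐ v (x)|²`. [folklore] -/
theorem sq_norm_famVec_levelFam (m : ℕ) (v : 𝔼 → 𝔼) (x : 𝔼) :
    ‖famVec (levelFam m v) x‖ ^ 2 = levelSq m v x := by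
  rw [sq_norm_famVec, sum_sq_levelFam]

/-- `‖famVec (vortFam m v) x‖² = |∇ᵐ Ω (x)|²`. [folklore] -/
theorem sq_norm_famVec_vortFam (m : ℕ) (v : 𝔼 → 𝔼) (x : 𝔼) :
    ‖famVec (vortFam m v) x‖ ^ 2 = vortSq m v x := by
  rw [sq_norm_famVec, sum_sq_vortFam]

/-- `‖D(famVec (levelFam m v))(x)‖² ≤ |∇^{m+1} v (x)|²`. [folklore] -/
theorem sq_norm_fderiv_famVec_levelFam_le (hv : ContDiff ℝ ∞ v) (m : ℕ) (x : 𝔼) :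
    ‖fderiv ℝ (famVec (levelFam m v)) x‖ ^ 2 ≤ levelSq (m + 1) v x := by
  rw [← sum_sq_pderiv_levelFam]
  exact sq_norm_fderiv_famVec_le (fun c => (contDiff_levelFam hv m c).differentiable (by simp)) x

/-- `‖D(famVec (vortFam m v))(x)‖² ≤ |∇^{m+1} Ω (x)|²`. [folklore] -/
theorem sq_norm_fderiv_famVec_vortFam_le (hv : ContDiff ℝ ∞ v) (m : ℕ) (x : 𝔼) :
    ‖fderiv ℝ (famVec (vortFam m v)) x‖ ^ 2 ≤ vortSq (m + 1) v x := by
  rw [← sum_sq_pderiv_vortFam]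
  exact sq_norm_fderiv_famVec_le (fun c => (contDiff_vortFam hv m c).differentiable (by simp)) x

end Levels

/-! ## Bridges to the first-order vocabulary of `VectorCalculus`

The tree's `Literature.Analysis.FluidPDE.VectorCalculus` (same namespace `Literature.Fluid`) has the
coordinate-free first-order notions `partialDeriv e v x = Dv(x) e`, `divergence`/`IsDivFree`,
the Frobenius norm `frobeniusNormSq L = ∑ᵢ ‖L bᵢ‖²` and the spin matrix
`spin v x = Dv(x) − Dv(x)ᵀ`. The coordinate objects of this file are their componentwise and
higher-order counterparts; the order-`0`/`1` identifications are proved here so that consumers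
keep a single gradient/vorticity vocabulary: `pderiv l f = partialDeriv eₗ f` (definitional),
`∂ₗvᵢ = (partialDeriv eₗ v)ᵢ`, `div v = ∑ᵢ ∂ᵢvᵢ` (so `IsDivFree v` is the coordinate
hypothesis `∀ x, ∑ᵢ ∂ᵢvᵢ(x) = 0` used below and in the consumers), `levelSq 1 v = |Dv|²_F`,
`Ω_{ki} = (spin v eₖ)ᵢ` and `vortSq 0 v = |spin v|²_F` (whence, on `ℝ³`,
`vortSq 0 v = 2 ‖curl v‖²` by `VectorCalculus.norm_curl_sq_eq_frobeniusNormSq_spin`). -/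

section Bridges

/-- `stdVec l` is Mathlib's standard orthonormal basis vector `EuclideanSpace.basisFun ι ℝ l`
(`EuclideanSpace.basisFun_apply`). [folklore] -/
theorem stdVec_eq_basisFun (l : ι) : (stdVec l : 𝔼) = EuclideanSpace.basisFun ι ℝ l :=
  (EuclideanSpace.basisFun_apply ι ℝ l).symm

/-- **`∂ₗ = partialDeriv eₗ`** (definitionally): the coordinate partial derivative of this file is
the tree's directional derivative `Fluid.partialDeriv` (`VectorCalculus`) along `eₗ`. [folklore] -/
theorem pderiv_eq_partialDeriv (l : ι) (f : 𝔼 → ℝ) :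
    pderiv l f = partialDeriv (stdVec l : 𝔼) f := rfl

omit [DecidableEq ι] in
/-- Components of the derivative of a vector field: `(Dv(x) w)ᵢ = D vᵢ (x) w` for `v`
differentiable at `x` (chain rule with the projection `EuclideanSpace.proj i`). [folklore] -/
theorem euclidean_fderiv_apply_comp {X : Type*} [NormedAddCommGroup X] [NormedSpace ℝ X]
    {v : X → 𝔼} {x : X} (hv : DifferentiableAt ℝ v x) (w : X) (i : ι) :
    fderiv ℝ v x w i = fderiv ℝ (fun y => v y i) x w := by
  have h1 : HasFDerivAt (fun y => v y i) ((EuclideanSpace.proj i : 𝔼 →L[ℝ] ℝ).comp (fderiv ℝ v x)) x :=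
    (EuclideanSpace.proj i : 𝔼 →L[ℝ] ℝ).hasFDerivAt.comp x hv.hasFDerivAt
  rw [h1.fderiv]
  rfl

/-- **`∂ₗ vᵢ = (partialDeriv eₗ v)ᵢ`**: the coordinate partial of a component is the component of
the tree's `partialDeriv` of the field (`v` differentiable at `x`). [folklore] -/
theorem pderiv_comp_eq_partialDeriv_apply {v : 𝔼 → 𝔼} {x : 𝔼} (hv : DifferentiableAt ℝ v x)
    (l i : ι) : pderiv l (fun y => v y i) x = partialDeriv (stdVec l : 𝔼) v x i := by
  rw [partialDeriv_apply, euclidean_fderiv_apply_comp hv, pderiv_apply]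

/-- **`div v = ∑ᵢ ∂ᵢ vᵢ`**: the tree's `Fluid.divergence` (trace of `Dv`) in coordinates, for `v`
differentiable at `x` (`divergence_eq_sum_inner_fderiv` with the standard basis). [folklore] -/
theorem divergence_eq_sum_pderiv {v : 𝔼 → 𝔼} {x : 𝔼} (hv : DifferentiableAt ℝ v x) :
    VectorCalculus.divergence v x = ∑ i, pderiv i (fun y => v y i) x := by
  rw [divergence_eq_sum_inner_fderiv (EuclideanSpace.basisFun ι ℝ)]
  refine Finset.sum_congr rfl fun i _ => ?_
  rw [← stdVec_eq_basisFun, stdVec, EuclideanSpace.inner_single_left]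
  simp only [map_one, one_mul]
  rw [euclidean_fderiv_apply_comp hv]
  rfl

/-- **`IsDivFree` in coordinates**: a differentiable divergence-free field (`Fluid.IsDivFree`,
the hypothesis of every Navier–Stokes statement in the tree) satisfies the coordinate identity
`∑ᵢ ∂ᵢ vᵢ = 0` used in this file (`sum_pderiv_ipderiv_eq_zero`) and its consumers. [folklore] -/
theorem VectorCalculus.IsDivFree.sum_pderiv_comp_eq_zero {v : 𝔼 → 𝔼} (hdiv : VectorCalculus.IsDivFree v)
    (hv : Differentiable ℝ v) (x : 𝔼) : ∑ i, pderiv i (fun y => v y i) x = 0 := by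
  rw [← divergence_eq_sum_pderiv (hv x)]
  exact hdiv x

/-- Conversely, the coordinate identity `∑ᵢ ∂ᵢ vᵢ = 0` gives `Fluid.IsDivFree` for a
differentiable field. [folklore] -/
theorem isDivFree_of_sum_pderiv_comp_eq_zero {v : 𝔼 → 𝔼} (hv : Differentiable ℝ v)
    (h : ∀ x, ∑ i, pderiv i (fun y => v y i) x = 0) : VectorCalculus.IsDivFree v := fun x => by
  rw [divergence_eq_sum_pderiv (hv x)]
  exact h x

/-- **Order `0`**: `levelSq 0 v x = ‖v x‖²`. [folklore] -/
theorem levelSq_zero_eq_norm_sq (v : 𝔼 → 𝔼) (x : 𝔼) :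
    levelSq 0 v x = ‖v x‖ ^ 2 := by
  rw [EuclideanSpace.real_norm_sq_eq, levelSq]
  exact Finset.sum_congr rfl fun i _ => dnormSq_zero _ _

/-- **Order `1`: `levelSq 1 v = |Dv|²_F`** — the coordinate tensor norm of the first derivative is
the tree's Frobenius norm `Fluid.frobeniusNormSq (fderiv ℝ v x)` (`VectorCalculus`; the density
of `gradNormSq`), for `v` differentiable at `x`. [folklore] -/
theorem levelSq_one_eq_frobeniusNormSq {v : 𝔼 → 𝔼} {x : 𝔼} (hv : DifferentiableAt ℝ v x) :
    levelSq 1 v x = frobeniusNormSq (fderiv ℝ v x) := by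
  rw [frobeniusNormSq_eq_sum (EuclideanSpace.basisFun ι ℝ), levelSq_succ_eq,
    Fintype.sum_unique]
  refine Finset.sum_congr rfl fun k _ => ?_
  rw [EuclideanSpace.real_norm_sq_eq]
  refine Finset.sum_congr rfl fun i _ => ?_
  rw [← stdVec_eq_basisFun, euclidean_fderiv_apply_comp hv, ipderiv_zero, pderiv_apply]

/-- **`Ω_{ki} = (spin v eₖ)ᵢ`**: the vorticity components of this file are the matrix entries of
the tree's spin matrix `Fluid.spin v x = Dv(x) − Dv(x)ᵀ` (`VectorCalculus`), for `v`
differentiable at `x` (`((Dv)ᵀ eₖ)ᵢ = ⟪Dv eᵢ, eₖ⟫ = ∂ᵢ vₖ`). [folklore] -/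
theorem vortComp_eq_spin_apply {v : 𝔼 → 𝔼} {x : 𝔼} (hv : DifferentiableAt ℝ v x) (k i : ι) :
    vortComp v k i x = spin v x (stdVec k) i := by
  have hadj : (ContinuousLinearMap.adjoint (fderiv ℝ v x) (stdVec k : 𝔼)) i =
      pderiv i (fun y => v y k) x := by
    have h1 : (ContinuousLinearMap.adjoint (fderiv ℝ v x) (stdVec k : 𝔼)) i =
        @inner ℝ 𝔼 _ (stdVec i : 𝔼) (ContinuousLinearMap.adjoint (fderiv ℝ v x) (stdVec k : 𝔼)) := by
      rw [stdVec, EuclideanSpace.inner_single_left]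
      simp
    rw [h1, ContinuousLinearMap.adjoint_inner_right, stdVec, stdVec,
      EuclideanSpace.inner_single_right]
    simp only [one_mul, RCLike.conj_to_real]
    rw [euclidean_fderiv_apply_comp hv, pderiv_apply]
  rw [vortComp, spin, FunLike.coe_sub, Pi.sub_apply, PiLp.sub_apply, hadj,
    euclidean_fderiv_apply_comp hv, pderiv_apply]

/-- **Order `0` for the vorticity: `vortSq 0 v = |spin v|²_F`** (`Fluid.frobeniusNormSq` of
`Fluid.spin`), for `v` differentiable at `x`; on `ℝ³` this is `2 ‖curl v x‖²` by
`VectorCalculus.norm_curl_sq_eq_frobeniusNormSq_spin`. [folklore] -/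
theorem vortSq_zero_eq_frobeniusNormSq_spin {v : 𝔼 → 𝔼} {x : 𝔼} (hv : DifferentiableAt ℝ v x) :
    vortSq 0 v x = frobeniusNormSq (spin v x) := by
  rw [frobeniusNormSq_eq_sum (EuclideanSpace.basisFun ι ℝ), vortSq]
  refine Finset.sum_congr rfl fun k _ => ?_
  rw [EuclideanSpace.real_norm_sq_eq]
  refine Finset.sum_congr rfl fun i _ => ?_
  rw [dnormSq_zero, ← stdVec_eq_basisFun, vortComp_eq_spin_apply hv]

end Bridges

end Literature.Analysis.FluidPDE



end
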